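import Summits.Ventures.YMGap.FlowData.TwoDimMassGapPrimeEquality
import Summits.Ventures.LatticeQCDFlow.Scoring.OnePlaquetteBessel
import Summits.Ventures.LatticeQCDFlow.Scoring.BesselIRatioPowerLimit
import Literature.Analysis.FunctionSpaces.BesselITuranSharp
import HarnessLib

/-!
# Venture YMGap, track Y3 FLOW-DATA — the d = 2 ANCHOR RELATION between the two typed gaps of the circle:
# `2·E₁ < m′ < 2·E₁ + L·ln(3/2)` on `(ℤ/L)¹` at EVERY Wilson coupling `β > 0` (theorems only)

HONEST FRAMING: venture file of the cell `pub-ymgap` (QuantumFields programme), track Y3; companion of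
`TwoDimTorelonEquality` (`E₁((ℤ/L)¹; β) = L·(−ln u(β))`, `u = I₂/I₁`) and `TwoDimMassGapPrimeEquality`
(`m′((ℤ/L)¹; β) = L·(−ln(I₃(β)/I₁(β)))`).  Theory dimension two (one spatial dimension), finite circle, exactly
solvable; no number of the FLOW-TABLE, no row, nothing about `k ≥ 2`, `L → ∞`, the continuum or a mass gap in the
thermodynamic sense.

What is new.  The two d = 2 equalities express the torelon energy `E₁` (FLOW-PLAN O1) and the trivial-flux gap `m′`
(FLOW-PLAN O5) of the SU(2) circle through the fundamental and the adjoint character ratios `u = I₂/I₁` and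
`a₁ = I₃/I₁`.  The SHARP two-sided Turán inequality for modified Bessel functions (Thiruvenkatachar–Nanjundiah 1951 /
Joshi–Bissu 1991 / Baricz 2010, Theorem 2.1 at `ν = 2`; tree file
`Literature/Analysis/FunctionSpaces/BesselITuranSharp.lean`: `2/3 < I₁I₃/I₂² < 1` for `x > 0`) says exactly
`(2/3)·u² < a₁ < u²`, hence:

* `su2RectMassGapPrime_sliceOne_sub_two_mul` — the identity `m′ − 2E₁ = L·ln(I₂²/(I₁I₃))`;
* ★ `two_mul_su2TorelonEnergy_lt_su2RectMassGapPrime_sliceOne` — **`2·E₁((ℤ/L)¹; β) < m′((ℤ/L)¹; β)`** for every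
  `L ≥ 1`, `β > 0`: on the circle the lightest trivial-flux excitation (a fundamental torelon–antitorelon pair fused
  into the adjoint line) is STRICTLY heavier than two free torelons;
* ★ `su2RectMassGapPrime_sliceOne_lt_two_mul_add` — **`m′ < 2·E₁ + L·ln(3/2)`**: but by less than `ln(3/2)` per
  link, uniformly in `β`;
* `su2RectMassGapPrime_sliceOne_div_mem_Ioo` — the ratio form `2 < m′/E₁ < 2 + ln(3/2)/(−ln u(β))`;
* `su2AdjointRatio_mem_Ioo` — the character-ratio form `(2/3)·u(β)² < I₃(β)/I₁(β) < u(β)²` (a check every d = 2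
  STEP-0 cell `(a_½, a_1)` of the table's T-2D anchor must pass).

BOTH ENDS ARE SHARP (§ Asymptotics): as `β → 0⁺`, `m′ − 2E₁ → L·ln(3/2)` and `m′/E₁ → 2`
(`tendsto_su2RectMassGapPrime_sub_two_mul_nhdsWithin_zero`, `tendsto_su2RectMassGapPrime_div_nhdsWithin_zero`; squeeze
`6/(2+√(β²+4)) ≤ I₂²/(I₁I₃) ≤ (3+√(β²+9))/4` from the tree's Amos-type ratio bounds); as `β → ∞` the WEAK-COUPLING LAWS
of the circle hold: `β·E₁ → (3/2)·L`, `β·m′ → 4·L`, `β·(m′ − 2E₁) → L`, `m′/E₁ → 8/3`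
(`tendsto_mul_su2TorelonEnergy_sliceOne_atTop`, `tendsto_mul_su2RectMassGapPrime_sliceOne_atTop`,
`tendsto_mul_sub_two_mul_atTop`, `tendsto_su2RectMassGapPrime_div_atTop`; from the tree's `x·log(I_m/I_{m+1}) → m + ½`,
`Scoring.BesselIRatioPowerLimit`).  So on the circle the ratio `m′/E₁` runs from `2` (strong coupling) to `8/3` (weak
coupling), staying in `(2, 2 + ln(3/2)/(−ln u(β)))` throughout.

References: I. Montvay, G. Münster (1994) §3.2.6 [cite: MontvayMunster1994, §3.2.6]; Á. Baricz, Bull. Aust. Math.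
Soc. 82 (2010) Thm 2.1 [cite: Baricz2010TuranBessel, Theorem 2.1]; M. Reed, B. Simon IV (1978) XIII.12
[cite: ReedSimonIV1978, Thm XIII.44].
-/

noncomputable section

open Literature.Analysis.FunctionSpaces
open Summit.Ventures.YMGap.Conjectures (su2CharacterRatio su2CharacterRatio_pos)
open Summit.Ventures.LatticeQCDFlow.Scoring (onePlaquetteExpectSU2_cos_eq_besselI_div)

namespace Summit.Ventures.YMGap.FlowData

section TwoDimRatio

variable {β : ℝ}

/-- Positivity of the integral-defined `I_n(β)` for `β > 0` (bridge to the series copy). [folklore] -/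
private theorem besselI_pos_aux (hβ : 0 < β) (n : ℕ) : 0 < besselI n β := by
  rw [besselI_eq_latticeModels_besselI]
  exact Literature.Probability.LatticeModels.besselI_pos hβ _

/-- **The character-ratio form of the sharp Turán inequality at `ν = 2`**: `(2/3)·u(β)² < I₃(β)/I₁(β) < u(β)²`,
`u = su2CharacterRatio = I₂/I₁` (the adjoint one-plaquette ratio lies strictly between `(2/3)u²` and `u²`).
[cite: Baricz2010TuranBessel, Theorem 2.1 (2.1) at ν = 2] -/
theorem su2AdjointRatio_mem_Ioo (hβ : 0 < β) :
    besselI 3 β / besselI 1 β ∈ Set.Ioo (2 / 3 * su2CharacterRatio β ^ 2) (su2CharacterRatio β ^ 2) := by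
  have hu : su2CharacterRatio β = besselI 2 β / besselI 1 β := onePlaquetteExpectSU2_cos_eq_besselI_div β
  have h1 := besselI_pos_aux hβ 1
  have h2 := besselI_pos_aux hβ 2
  have h3 := besselI_pos_aux hβ 3
  have hT := besselI_one_mul_three_div_two_sq_mem_Ioo hβ
  have key : besselI 3 β / besselI 1 β =
      besselI 1 β * besselI 3 β / besselI 2 β ^ 2 * (besselI 2 β / besselI 1 β) ^ 2 := by
    field_simp
  have hu2 : 0 < (besselI 2 β / besselI 1 β) ^ 2 := by positivity
  rw [hu, key]
  exact ⟨mul_lt_mul_of_pos_right hT.1 hu2, (mul_lt_mul_of_pos_right hT.2 hu2).trans_eq (one_mul _)⟩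

/-- **The identity** `m′((ℤ/L)¹; β) − 2·E₁((ℤ/L)¹; β) = L · ln( I₂(β)² / (I₁(β) I₃(β)) )` (the two d = 2 equalities
combined). [cite: MontvayMunster1994, §3.2.6] -/
theorem su2RectMassGapPrime_sliceOne_sub_two_mul (hβ : 0 < β) (L : ℕ) [NeZero L] :
    su2RectMassGapPrime β (fun _ : Fin 1 => L) - 2 * su2TorelonEnergy β 1 L 0 =
      (L : ℝ) * Real.log (besselI 2 β ^ 2 / (besselI 1 β * besselI 3 β)) := by
  have hu : su2CharacterRatio β = besselI 2 β / besselI 1 β := onePlaquetteExpectSU2_cos_eq_besselI_div β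
  have h1 := besselI_pos_aux hβ 1
  have h2 := besselI_pos_aux hβ 2
  have h3 := besselI_pos_aux hβ 3
  rw [su2RectMassGapPrime_sliceOne_eq hβ L, su2TorelonEnergy_sliceOne_eq hβ L, hu,
    Real.log_div h3.ne' h1.ne', Real.log_div h2.ne' h1.ne',
    Real.log_div (pow_pos h2 2).ne' (mul_pos h1 h3).ne', Real.log_mul h1.ne' h3.ne', Real.log_pow]
  push_cast
  ring

/-- ★ **`2·E₁ < m′` on the circle, at every coupling**: for every `L ≥ 1` and `β > 0`,
`2 · su2TorelonEnergy β 1 L 0 < su2RectMassGapPrime β (fun _ => L)` — the strict Turán inequality `I₁I₃ < I₂²`.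
[cite: Baricz2010TuranBessel, Theorem 2.1 (left inequality at ν = 2)] -/
theorem two_mul_su2TorelonEnergy_lt_su2RectMassGapPrime_sliceOne (hβ : 0 < β) (L : ℕ) [NeZero L] :
    2 * su2TorelonEnergy β 1 L 0 < su2RectMassGapPrime β (fun _ : Fin 1 => L) := by
  have h := su2RectMassGapPrime_sliceOne_sub_two_mul hβ L
  have h1 := besselI_pos_aux hβ 1
  have h2 := besselI_pos_aux hβ 2
  have h3 := besselI_pos_aux hβ 3
  have hT := (besselI_one_mul_three_div_two_sq_mem_Ioo hβ).2
  rw [div_lt_one (pow_pos h2 2)] at hT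
  have hlog : 0 < Real.log (besselI 2 β ^ 2 / (besselI 1 β * besselI 3 β)) :=
    Real.log_pos ((one_lt_div (mul_pos h1 h3)).2 hT)
  have hL : (0 : ℝ) < L := Nat.cast_pos.2 (Nat.pos_of_ne_zero (NeZero.ne L))
  nlinarith [mul_pos hL hlog]

/-- ★ **`m′ < 2·E₁ + L·ln(3/2)` on the circle, at every coupling**: for every `L ≥ 1` and `β > 0`,
`su2RectMassGapPrime β (fun _ => L) < 2 · su2TorelonEnergy β 1 L 0 + L · log (3/2)` — the right-hand Turán
bound `(2/3)·I₂² < I₁I₃`. [cite: Baricz2010TuranBessel, Theorem 2.1 (right inequality at ν = 2)] -/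
theorem su2RectMassGapPrime_sliceOne_lt_two_mul_add (hβ : 0 < β) (L : ℕ) [NeZero L] :
    su2RectMassGapPrime β (fun _ : Fin 1 => L) < 2 * su2TorelonEnergy β 1 L 0 + (L : ℝ) * Real.log (3 / 2) := by
  have h := su2RectMassGapPrime_sliceOne_sub_two_mul hβ L
  have h1 := besselI_pos_aux hβ 1
  have h2 := besselI_pos_aux hβ 2
  have h3 := besselI_pos_aux hβ 3
  have hT := (besselI_one_mul_three_div_two_sq_mem_Ioo hβ).1
  rw [lt_div_iff₀ (pow_pos h2 2)] at hT
  have hlt : besselI 2 β ^ 2 / (besselI 1 β * besselI 3 β) < 3 / 2 := by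
    rw [div_lt_iff₀ (mul_pos h1 h3)]
    linarith
  have hlog : Real.log (besselI 2 β ^ 2 / (besselI 1 β * besselI 3 β)) < Real.log (3 / 2) :=
    Real.log_lt_log (div_pos (pow_pos h2 2) (mul_pos h1 h3)) hlt
  have hL : (0 : ℝ) < L := Nat.cast_pos.2 (Nat.pos_of_ne_zero (NeZero.ne L))
  nlinarith [mul_lt_mul_of_pos_left hlog hL]

/-- **The two-sided d = 2 anchor in one statement**: `m′ − 2E₁ ∈ (0, L·ln(3/2))` on `(ℤ/L)¹`, every `β > 0`.
[cite: Baricz2010TuranBessel, Theorem 2.1 at ν = 2] -/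
theorem su2RectMassGapPrime_sliceOne_sub_two_mul_mem_Ioo (hβ : 0 < β) (L : ℕ) [NeZero L] :
    su2RectMassGapPrime β (fun _ : Fin 1 => L) - 2 * su2TorelonEnergy β 1 L 0 ∈
      Set.Ioo 0 ((L : ℝ) * Real.log (3 / 2)) := by
  constructor
  · linarith [two_mul_su2TorelonEnergy_lt_su2RectMassGapPrime_sliceOne hβ L]
  · linarith [su2RectMassGapPrime_sliceOne_lt_two_mul_add hβ L]

/-- **Ratio form**: `2 < m′/E₁ < 2 + ln(3/2)/(−ln u(β))` on the circle (`E₁ = L(−ln u) > 0` since `0 < u < 1`),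
every `L ≥ 1`, `β > 0`. [cite: Baricz2010TuranBessel, Theorem 2.1 at ν = 2] -/
theorem su2RectMassGapPrime_sliceOne_div_mem_Ioo (hβ : 0 < β) (L : ℕ) [NeZero L] :
    su2RectMassGapPrime β (fun _ : Fin 1 => L) / su2TorelonEnergy β 1 L 0 ∈
      Set.Ioo 2 (2 + Real.log (3 / 2) / (-Real.log (su2CharacterRatio β))) := by
  have hE := su2TorelonEnergy_sliceOne_eq hβ L
  have hEpos : 0 < su2TorelonEnergy β 1 L 0 := su2TorelonEnergy_pos' hβ.ne' 1 L 0
  have hL : (0 : ℝ) < L := Nat.cast_pos.2 (Nat.pos_of_ne_zero (NeZero.ne L))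
  have hlu : 0 < -Real.log (su2CharacterRatio β) := by
    have : 0 < (L : ℝ) * (-Real.log (su2CharacterRatio β)) := by rw [← hE]; exact hEpos
    exact pos_of_mul_pos_right this hL.le
  have hne : Real.log (su2CharacterRatio β) ≠ 0 := (neg_pos.1 hlu).ne
  constructor
  · rw [lt_div_iff₀ hEpos]
    exact two_mul_su2TorelonEnergy_lt_su2RectMassGapPrime_sliceOne hβ L
  · rw [div_lt_iff₀ hEpos]
    have hrhs : (2 + Real.log (3 / 2) / -Real.log (su2CharacterRatio β)) * su2TorelonEnergy β 1 L 0 =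
        2 * su2TorelonEnergy β 1 L 0 + (L : ℝ) * Real.log (3 / 2) := by
      rw [hE]
      field_simp
      ring
    rw [hrhs]
    exact su2RectMassGapPrime_sliceOne_lt_two_mul_add hβ L

end TwoDimRatio

section TwoDimAsymptotics

open Filter Topology
open Summit.Ventures.LatticeQCDFlow.Scoring (tendsto_mul_log_besselI_div_succ)

variable {β : ℝ}

/-- `−log(a/b) = log(b/a)` for positive reals (bookkeeping). [folklore] -/
private theorem neg_log_div_eq {a b : ℝ} (ha : 0 < a) (hb : 0 < b) : -Real.log (a / b) = Real.log (b / a) := by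
  rw [Real.log_div ha.ne' hb.ne', Real.log_div hb.ne' ha.ne']; ring

/-- ★ **Weak-coupling law of the d = 2 torelon**: `β · E₁((ℤ/L)¹; β) → (3/2)·L` as `β → ∞`
(`E₁ = L·log(I₁/I₂)` and `x·log(I₁(x)/I₂(x)) → 3/2`). [cite: MontvayMunster1994, §3.2.6] -/
theorem tendsto_mul_su2TorelonEnergy_sliceOne_atTop (L : ℕ) [NeZero L] :
    Tendsto (fun β : ℝ => β * su2TorelonEnergy β 1 L 0) atTop (𝓝 (3 / 2 * (L : ℝ))) := by
  have h := (tendsto_mul_log_besselI_div_succ 1).const_mul (L : ℝ)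
  have hlim : (L : ℝ) * (((1 : ℕ) : ℝ) + 1 / 2) = 3 / 2 * (L : ℝ) := by push_cast; ring
  rw [hlim] at h
  refine h.congr' ?_
  filter_upwards [eventually_gt_atTop 0] with x hx
  have hu : su2CharacterRatio x = besselI 2 x / besselI 1 x := onePlaquetteExpectSU2_cos_eq_besselI_div x
  rw [su2TorelonEnergy_sliceOne_eq hx L, hu, neg_log_div_eq (besselI_pos_aux hx 2) (besselI_pos_aux hx 1)]
  ring

/-- ★ **Weak-coupling law of the d = 2 trivial-flux gap**: `β · m′((ℤ/L)¹; β) → 4·L` as `β → ∞`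
(`m′ = L·(log(I₁/I₂) + log(I₂/I₃))`, limits `3/2 + 5/2`). [cite: MontvayMunster1994, §3.2.6] -/
theorem tendsto_mul_su2RectMassGapPrime_sliceOne_atTop (L : ℕ) [NeZero L] :
    Tendsto (fun β : ℝ => β * su2RectMassGapPrime β (fun _ : Fin 1 => L)) atTop (𝓝 (4 * (L : ℝ))) := by
  have h := ((tendsto_mul_log_besselI_div_succ 1).add (tendsto_mul_log_besselI_div_succ 2)).const_mul (L : ℝ)
  have hlim : (L : ℝ) * ((((1 : ℕ) : ℝ) + 1 / 2) + ((((2 : ℕ) : ℝ) + 1 / 2))) = 4 * (L : ℝ) := by push_cast; ring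
  rw [hlim] at h
  refine h.congr' ?_
  filter_upwards [eventually_gt_atTop 0] with x hx
  have h1 := besselI_pos_aux hx 1
  have h2 := besselI_pos_aux hx 2
  have h3 := besselI_pos_aux hx 3
  rw [su2RectMassGapPrime_sliceOne_eq hx L, neg_log_div_eq h3 h1,
    show besselI 1 x / besselI 3 x = (besselI 1 x / besselI 2 x) * (besselI 2 x / besselI 3 x) by
      field_simp,
    Real.log_mul (div_pos h1 h2).ne' (div_pos h2 h3).ne']
  push_cast
  ring

/-- `β·(m′ − 2E₁) → L` as `β → ∞` on `(ℤ/L)¹` (the lower end `2E₁ < m′` is sharp at weak coupling).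
[cite: MontvayMunster1994, §3.2.6] -/
theorem tendsto_mul_sub_two_mul_atTop (L : ℕ) [NeZero L] :
    Tendsto (fun β : ℝ => β * (su2RectMassGapPrime β (fun _ : Fin 1 => L) - 2 * su2TorelonEnergy β 1 L 0))
      atTop (𝓝 (L : ℝ)) := by
  have h := (tendsto_mul_su2RectMassGapPrime_sliceOne_atTop L).sub
    ((tendsto_mul_su2TorelonEnergy_sliceOne_atTop L).const_mul 2)
  have hlim : 4 * (L : ℝ) - 2 * (3 / 2 * (L : ℝ)) = (L : ℝ) := by ring
  rw [hlim] at h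
  refine h.congr' (Eventually.of_forall fun x => ?_)
  simp only
  ring

/-- ★ **`m′/E₁ → 8/3` as `β → ∞`** on the circle `(ℤ/L)¹` (ratio of the two weak-coupling laws).
[cite: MontvayMunster1994, §3.2.6] -/
theorem tendsto_su2RectMassGapPrime_div_atTop (L : ℕ) [NeZero L] :
    Tendsto (fun β : ℝ => su2RectMassGapPrime β (fun _ : Fin 1 => L) / su2TorelonEnergy β 1 L 0)
      atTop (𝓝 (8 / 3)) := by
  have hL : (0 : ℝ) < L := Nat.cast_pos.2 (Nat.pos_of_ne_zero (NeZero.ne L))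
  have h := (tendsto_mul_su2RectMassGapPrime_sliceOne_atTop L).div
    (tendsto_mul_su2TorelonEnergy_sliceOne_atTop L) (by positivity)
  have hlim : 4 * (L : ℝ) / (3 / 2 * (L : ℝ)) = 8 / 3 := by field_simp; ring
  rw [hlim] at h
  refine h.congr' ?_
  filter_upwards [eventually_gt_atTop 0] with x hx
  simp only [Pi.div_apply]
  rw [mul_div_mul_left _ _ hx.ne']

/-- **Strong-coupling squeeze for the Turán quotient at `ν = 2`**: for `x > 0`,
`6/(2 + √(x²+4)) ≤ I₂(x)²/(I₁(x)I₃(x)) ≤ (3 + √(x²+9))/4` (Amos' lower ratio bound and the termwise upper ratio bound of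
the tree, `Literature.Probability.LatticeModels.div_le_besselI_succ_div_besselI` / `besselI_succ_le_div_mul`); both ends
tend to `3/2` as `x → 0⁺`. [cite: Amos1974, (9) p. 241] -/
theorem besselI_two_sq_div_mem_Icc (hx : 0 < β) :
    besselI 2 β ^ 2 / (besselI 1 β * besselI 3 β) ∈
      Set.Icc (6 / (2 + Real.sqrt (β ^ 2 + 4))) ((3 + Real.sqrt (β ^ 2 + 9)) / 4) := by
  have h1 := besselI_pos_aux hx 1
  have h2 := besselI_pos_aux hx 2
  have h3 := besselI_pos_aux hx 3
  -- the two ratio lower bounds (Amos), transported from the series copy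
  have hA1 : β / (2 + Real.sqrt (β ^ 2 + 4)) ≤ besselI 2 β / besselI 1 β := by
    have h := Literature.Probability.LatticeModels.div_le_besselI_succ_div_besselI hx 1
    rw [← besselI_eq_latticeModels_besselI, ← besselI_eq_latticeModels_besselI] at h
    convert h using 2
    norm_num
  have hA2 : β / (3 + Real.sqrt (β ^ 2 + 9)) ≤ besselI 3 β / besselI 2 β := by
    have h := Literature.Probability.LatticeModels.div_le_besselI_succ_div_besselI hx 2
    rw [← besselI_eq_latticeModels_besselI, ← besselI_eq_latticeModels_besselI] at h
    convert h using 2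
    norm_num
  -- the two termwise upper bounds
  have hB1 : besselI 2 β ≤ β / 4 * besselI 1 β := by
    have h := besselI_succ_le_div_mul 1 hx.le
    norm_num at h
    linarith
  have hB2 : besselI 3 β ≤ β / 6 * besselI 2 β := by
    have h := besselI_succ_le_div_mul 2 hx.le
    norm_num at h
    linarith
  have hs4 : 0 < 2 + Real.sqrt (β ^ 2 + 4) := by positivity
  have hs9 : 0 < 3 + Real.sqrt (β ^ 2 + 9) := by positivity
  rw [le_div_iff₀ h1] at hA1
  rw [le_div_iff₀ h2] at hA2
  constructor
  · -- 6/(2+s4) ≤ I₂²/(I₁I₃)  ⟸  6·I₁I₃ ≤ (2+s4)·I₂²,  from I₃ ≤ (β/6) I₂ and β I₁ ≤ (2+s4) I₂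
    rw [div_le_div_iff₀ hs4 (mul_pos h1 h3)]
    have e1 : β / (2 + Real.sqrt (β ^ 2 + 4)) * besselI 1 β * (2 + Real.sqrt (β ^ 2 + 4)) = β * besselI 1 β := by
      field_simp
    nlinarith [mul_le_mul_of_nonneg_left hB2 h1.le, mul_le_mul_of_nonneg_right hA1 hs4.le,
      mul_le_mul_of_nonneg_left (mul_le_mul_of_nonneg_right hA1 hs4.le) h2.le]
  · -- I₂²/(I₁I₃) ≤ (3+s9)/4  ⟸  4·I₂² ≤ (3+s9)·I₁I₃, from I₂ ≤ (β/4) I₁ and β I₂ ≤ (3+s9) I₃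
    rw [div_le_div_iff₀ (mul_pos h1 h3) (by norm_num : (0 : ℝ) < 4)]
    have hB1' : 4 * besselI 2 β ≤ β * besselI 1 β := by linarith [hB1]
    have hA2' : β * besselI 2 β ≤ (3 + Real.sqrt (β ^ 2 + 9)) * besselI 3 β := by
      have e : β / (3 + Real.sqrt (β ^ 2 + 9)) * besselI 2 β * (3 + Real.sqrt (β ^ 2 + 9)) =
          β * besselI 2 β := by field_simp
      nlinarith [mul_le_mul_of_nonneg_right hA2 hs9.le]
    nlinarith [mul_le_mul_of_nonneg_left hB1' h2.le, mul_le_mul_of_nonneg_left hA2' h1.le]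

/-- `I₂(β)²/(I₁(β)I₃(β)) → 3/2` as `β → 0⁺` (squeeze). [cite: Amos1974, (9) p. 241] -/
theorem tendsto_besselI_two_sq_div_nhdsWithin_zero :
    Tendsto (fun β : ℝ => besselI 2 β ^ 2 / (besselI 1 β * besselI 3 β)) (𝓝[>] 0) (𝓝 (3 / 2)) := by
  have hs4 : Real.sqrt ((0 : ℝ) ^ 2 + 4) = 2 := by
    rw [show (0 : ℝ) ^ 2 + 4 = 2 ^ 2 by norm_num, Real.sqrt_sq (by norm_num)]
  have hs9 : Real.sqrt ((0 : ℝ) ^ 2 + 9) = 3 := by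
    rw [show (0 : ℝ) ^ 2 + 9 = 3 ^ 2 by norm_num, Real.sqrt_sq (by norm_num)]
  have hlo : Tendsto (fun β : ℝ => 6 / (2 + Real.sqrt (β ^ 2 + 4))) (𝓝[>] 0) (𝓝 (3 / 2)) := by
    have hc : Continuous fun β : ℝ => 6 / (2 + Real.sqrt (β ^ 2 + 4)) :=
      Continuous.div continuous_const (by fun_prop) fun β => by positivity
    have h : Tendsto (fun β : ℝ => 6 / (2 + Real.sqrt (β ^ 2 + 4))) (𝓝[>] 0)
        (𝓝 (6 / (2 + Real.sqrt ((0 : ℝ) ^ 2 + 4)))) := (hc.tendsto 0).mono_left nhdsWithin_le_nhds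
    rw [hs4] at h
    norm_num at h
    exact h
  have hhi : Tendsto (fun β : ℝ => (3 + Real.sqrt (β ^ 2 + 9)) / 4) (𝓝[>] 0) (𝓝 (3 / 2)) := by
    have hc : Continuous fun β : ℝ => (3 + Real.sqrt (β ^ 2 + 9)) / 4 := by fun_prop
    have h : Tendsto (fun β : ℝ => (3 + Real.sqrt (β ^ 2 + 9)) / 4) (𝓝[>] 0)
        (𝓝 ((3 + Real.sqrt ((0 : ℝ) ^ 2 + 9)) / 4)) := (hc.tendsto 0).mono_left nhdsWithin_le_nhds
    rw [hs9] at h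
    norm_num at h
    exact h
  refine tendsto_of_tendsto_of_tendsto_of_le_of_le' hlo hhi ?_ ?_
  · filter_upwards [self_mem_nhdsWithin] with β hβ using (besselI_two_sq_div_mem_Icc (β := β) hβ).1
  · filter_upwards [self_mem_nhdsWithin] with β hβ using (besselI_two_sq_div_mem_Icc (β := β) hβ).2

/-- ★ **Strong-coupling end**: `m′ − 2E₁ → L·ln(3/2)` as `β → 0⁺` on `(ℤ/L)¹` (the upper end of
`2E₁ < m′ < 2E₁ + L ln(3/2)` is sharp at strong coupling). [cite: MontvayMunster1994, §3.2.6] -/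
theorem tendsto_su2RectMassGapPrime_sub_two_mul_nhdsWithin_zero (L : ℕ) [NeZero L] :
    Tendsto (fun β : ℝ => su2RectMassGapPrime β (fun _ : Fin 1 => L) - 2 * su2TorelonEnergy β 1 L 0)
      (𝓝[>] 0) (𝓝 ((L : ℝ) * Real.log (3 / 2))) := by
  have h := (((Real.continuousAt_log (by norm_num : (3 / 2 : ℝ) ≠ 0)).tendsto.comp
    tendsto_besselI_two_sq_div_nhdsWithin_zero).const_mul (L : ℝ))
  refine h.congr' ?_
  filter_upwards [self_mem_nhdsWithin] with β hβ
  have hβ' : (0 : ℝ) < β := hβ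
  simp only [Function.comp_apply]
  exact (su2RectMassGapPrime_sliceOne_sub_two_mul hβ' L).symm

/-- The d = 2 torelon energy diverges at strong coupling: `E₁((ℤ/L)¹; β) → ∞` as `β → 0⁺`
(`E₁ = L(−ln u) ≥ L·ln(4/β)`). [cite: MontvayMunster1994, §3.2.6] -/
theorem tendsto_su2TorelonEnergy_sliceOne_nhdsWithin_zero (L : ℕ) [NeZero L] :
    Tendsto (fun β : ℝ => su2TorelonEnergy β 1 L 0) (𝓝[>] 0) atTop := by
  have hL : (1 : ℝ) ≤ L := by exact_mod_cast Nat.one_le_iff_ne_zero.2 (NeZero.ne L)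
  -- `log (4/β) → ∞`
  have h4 : Tendsto (fun β : ℝ => Real.log (4 * β⁻¹)) (𝓝[>] 0) atTop :=
    Real.tendsto_log_atTop.comp (tendsto_inv_nhdsGT_zero.const_mul_atTop (by norm_num))
  refine tendsto_atTop_mono' _ ?_ h4
  filter_upwards [self_mem_nhdsWithin] with β hβ
  have hβ' : (0 : ℝ) < β := hβ
  have h1 := besselI_pos_aux hβ' 1
  have h2 := besselI_pos_aux hβ' 2
  have hu : su2CharacterRatio β = besselI 2 β / besselI 1 β := onePlaquetteExpectSU2_cos_eq_besselI_div β
  have hule : su2CharacterRatio β ≤ β / 4 := by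
    rw [hu, div_le_iff₀ h1]
    have h := besselI_succ_le_div_mul 1 hβ'.le
    norm_num at h
    linarith
  have hupos : 0 < su2CharacterRatio β := su2CharacterRatio_pos hβ'
  rw [su2TorelonEnergy_sliceOne_eq hβ' L]
  have hlog : Real.log (4 * β⁻¹) ≤ -Real.log (su2CharacterRatio β) := by
    rw [← Real.log_inv]
    exact Real.log_le_log (by positivity) (by rw [le_inv_comm₀ (by positivity) hupos]; simpa [div_eq_mul_inv] using hule)
  have hnn : 0 ≤ -Real.log (su2CharacterRatio β) := by
    have hu1 : su2CharacterRatio β ≤ 1 := by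
      rw [hu, div_le_one h1]; exact besselI_succ_le 1 hβ'.le
    have := Real.log_nonpos hupos.le hu1
    linarith
  calc Real.log (4 * β⁻¹) ≤ -Real.log (su2CharacterRatio β) := hlog
    _ = 1 * -Real.log (su2CharacterRatio β) := (one_mul _).symm
    _ ≤ (L : ℝ) * -Real.log (su2CharacterRatio β) := mul_le_mul_of_nonneg_right hL hnn

/-- ★ **Strong-coupling end of the ratio**: `m′/E₁ → 2` as `β → 0⁺` on `(ℤ/L)¹`
(`m′/E₁ = 2 + (m′ − 2E₁)/E₁`, numerator bounded, `E₁ → ∞`). [cite: MontvayMunster1994, §3.2.6] -/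
theorem tendsto_su2RectMassGapPrime_div_nhdsWithin_zero (L : ℕ) [NeZero L] :
    Tendsto (fun β : ℝ => su2RectMassGapPrime β (fun _ : Fin 1 => L) / su2TorelonEnergy β 1 L 0)
      (𝓝[>] 0) (𝓝 2) := by
  have hq : Tendsto (fun β : ℝ => (su2RectMassGapPrime β (fun _ : Fin 1 => L) - 2 * su2TorelonEnergy β 1 L 0) /
      su2TorelonEnergy β 1 L 0) (𝓝[>] 0) (𝓝 0) :=
    (tendsto_su2RectMassGapPrime_sub_two_mul_nhdsWithin_zero L).div_atTop
      (tendsto_su2TorelonEnergy_sliceOne_nhdsWithin_zero L)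
  have h := hq.const_add 2
  rw [add_zero] at h
  refine h.congr' ?_
  filter_upwards [self_mem_nhdsWithin] with β hβ
  have hβ' : (0 : ℝ) < β := hβ
  have hE : 0 < su2TorelonEnergy β 1 L 0 := su2TorelonEnergy_pos' hβ'.ne' 1 L 0
  field_simp
  ring

end TwoDimAsymptotics

end Summit.Ventures.YMGap.FlowData
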